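import Literature.Computability.MetaComplexity.FregeMod
import Literature.Computability.MetaComplexity.DepthFregeSequents
import HarnessLib

/-!
# From Frege derivations with `MOD`-atoms to `F(MOD_a)`-proofs: hypothesis elimination and transfer

Support file for item `stmt-PneNP-11444` (`LinearGeneratorModPFregeHard`, the `AC⁰[p]`-Frege
rung of route `ExpanderLinearGenerators`), calibration line "for `p = 2` the rung fails".  The
construction (`…Mod2*.lean`) produces, in the `¬∧∨`-language with the `MOD₂` subformulas replaced
by fresh atoms, a hypothesis-free `textbookFrege` derivation of `¬H₁ ∨ (¬H₂ ∨ ⋯ (¬H_N ∨ goal))`,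
where the `Hⱼ` are the skeleta of the `MOD₂` axioms used.  This file turns such a derivation into a
genuine `textbookFrege(MOD_a)`-proof of the substituted goal, with depth and size accounting:

* `isModDerivation_map_subst` — **transfer**: an `F`-derivation from hypotheses `Γ`, pushed through
  `ψ ↦ (ofPropForm ψ).subst σ` for a substitution `σ` of `MOD`-formulas under which every used
  hypothesis becomes a `MOD_a` axiom, is an `F(MOD_a)`-derivation from no hypotheses;
* `size_ofPropForm_subst_le`, `altDepth_ofPropForm_subst_le` — the substituted lines grow by the
  factor `max |σ v|` in size and by `max depth (σ v)` in depth;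
* `exists_elim_hyps` — **hypothesis elimination** inside `textbookFrege`: from a derivation
  containing `¬H₁ ∨ (⋯ (¬H_N ∨ goal))` with all `Hⱼ ∈ Γ`, six lines per hypothesis (hypothesis,
  expansion, axiom, cut, cut, contraction) reach `goal`, all of size `≤ 2·|line| + 1` and depth
  `≤ depth + 2`;
* `exists_isModDepthProofOf_of_derivation` — the three combined: the packaged statement used by the
  final assembly.

Sources: S. Buss et al., *Proof complexity in algebraic systems and bounded depth Frege systems
with modular counting*, Comput. Complexity 6 (1996/97), Def. 1.1 (`F(MOD_a)`: the rules of `F`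
instantiated by formulas of the extended language, plus the `MOD_a` axioms); J. R. Shoenfield,
*Mathematical Logic* (1967), §2.6 (expansion, cut, contraction).  Bookkeeping folklore; no
definitions are introduced.
-/

set_option linter.dupNamespace false -- `Summit.PneNP.PneNP.…`: summit = sub-problem (D-0017)

namespace Summit.PneNP.PneNP.Theorems.ModTwo

open Literature.Computability.Complexity Literature.Computability.Complexity.PropForm
open Literature.Computability.MetaComplexity Literature.Computability.MetaComplexity.DepthFrege

/-! ### Substitution of `MOD`-formulas into `¬∧∨`-formulas -/

section Subst

variable {a : ℕ}

/-- Composition of substitutions on `PropFormMod`. [Cook–Reckhow 1979, §2] [folklore] -/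
theorem subst_subst_mod (τ σ : ℕ → PropFormMod a ℕ) (φ : PropFormMod a ℕ) :
    (φ.subst τ).subst σ = φ.subst fun v => (τ v).subst σ := by
  induction φ <;> simp_all [PropFormMod.subst]

/-- Pushing an instance of a `¬∧∨`-scheme through a `MOD`-substitution is an instance of the same
scheme. [Buss et al. 1997, Def. 1.1] [folklore] -/
theorem ofPropForm_subst_subst (τ : ℕ → PropForm ℕ) (σ : ℕ → PropFormMod a ℕ) (φ : PropForm ℕ) :
    (PropFormMod.ofPropForm (φ.subst τ)).subst σ =
      (PropFormMod.ofPropForm φ : PropFormMod a ℕ).subst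
        fun v => (PropFormMod.ofPropForm (τ v)).subst σ := by
  rw [PropFormMod.ofPropForm_subst, subst_subst_mod]

/-- Size of a substituted line: at most `|ψ| · S` when every `σ v` has size `≤ S` (`S ≥ 1`).
[folklore] -/
theorem size_ofPropForm_subst_le (σ : ℕ → PropFormMod a ℕ) {S : ℕ} (hS : ∀ v, (σ v).size ≤ S)
    (hS1 : 1 ≤ S) (ψ : PropForm ℕ) :
    ((PropFormMod.ofPropForm ψ : PropFormMod a ℕ).subst σ).size ≤ ψ.size * S := by
  induction ψ with
  | var v => simpa [PropFormMod.ofPropForm, PropFormMod.subst, size] using hS v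
  | const b => simp [PropFormMod.ofPropForm, PropFormMod.subst, size, PropFormMod.size, hS1]
  | neg φ ih =>
    simp only [PropFormMod.ofPropForm, PropFormMod.subst, PropFormMod.size, size, Nat.add_mul,
      one_mul]
    omega
  | conj φ ψ ih₁ ih₂ =>
    simp only [PropFormMod.ofPropForm, PropFormMod.subst, PropFormMod.size, size, Nat.add_mul,
      one_mul]
    omega
  | disj φ ψ ih₁ ih₂ =>
    simp only [PropFormMod.ofPropForm, PropFormMod.subst, PropFormMod.size, size, Nat.add_mul,
      one_mul]
    omega

/-- Auxiliary depth of a substituted line: at most `altDepthAux c ψ + D` when every `σ v` has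
auxiliary depth `≤ D` below every parent. [Krajíček 1995, §4.3] [folklore] -/
theorem altDepthAux_ofPropForm_subst_le (σ : ℕ → PropFormMod a ℕ) {D : ℕ}
    (hD : ∀ v c, PropFormMod.altDepthAux c (σ v) ≤ D) (ψ : PropForm ℕ) (c : ℕ) :
    PropFormMod.altDepthAux c ((PropFormMod.ofPropForm ψ : PropFormMod a ℕ).subst σ) ≤
      PropForm.altDepthAux c ψ + D := by
  induction ψ generalizing c with
  | var v => simpa [PropFormMod.ofPropForm, PropFormMod.subst, PropForm.altDepthAux] using hD v c
  | const b => simp [PropFormMod.ofPropForm, PropFormMod.subst, PropFormMod.altDepthAux]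
  | neg φ ih =>
    have := ih 1
    simp only [PropFormMod.ofPropForm, PropFormMod.subst, PropFormMod.altDepthAux,
      PropForm.altDepthAux]
    split_ifs <;> omega
  | conj φ ψ ih₁ ih₂ =>
    have := ih₁ 2; have := ih₂ 2
    simp only [PropFormMod.ofPropForm, PropFormMod.subst, PropFormMod.altDepthAux,
      PropForm.altDepthAux]
    split_ifs <;> omega
  | disj φ ψ ih₁ ih₂ =>
    have := ih₁ 3; have := ih₂ 3
    simp only [PropFormMod.ofPropForm, PropFormMod.subst, PropFormMod.altDepthAux,
      PropForm.altDepthAux]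
    split_ifs <;> omega

/-- Depth of a substituted line: at most `depth ψ + D`. [Krajíček 1995, §4.3] [folklore] -/
theorem altDepth_ofPropForm_subst_le (σ : ℕ → PropFormMod a ℕ) {D : ℕ}
    (hD : ∀ v c, PropFormMod.altDepthAux c (σ v) ≤ D) (ψ : PropForm ℕ) :
    ((PropFormMod.ofPropForm ψ : PropFormMod a ℕ).subst σ).altDepth ≤ ψ.altDepth + D :=
  altDepthAux_ofPropForm_subst_le σ hD ψ 0

/-! ### Transfer of derivations -/

/-- **Transfer.** Let `π` be an `F`-derivation from hypotheses `Γ` (lines over `¬∧∨`, the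
`MOD`-subformulas being atoms) and `σ` a substitution of `MOD`-formulas for atoms under which every
hypothesis occurring in `π` becomes a `MOD_a` axiom.  Then the substituted sequence is an
`F(MOD_a)`-derivation from no hypotheses: rule instances stay rule instances
(`ofPropForm_subst_subst`), hypotheses become axioms. [Buss et al. 1997, Def. 1.1] [folklore] -/
theorem isModDerivation_map_subst {F : FregeSystem} {Γ : Set (PropForm ℕ)} {π : List (PropForm ℕ)}
    (hπ : F.IsDerivation Γ π) (σ : ℕ → PropFormMod a ℕ)
    (hΓ : ∀ H ∈ π, H ∈ Γ → PropFormMod.IsModAxiom ((PropFormMod.ofPropForm H).subst σ)) :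
    F.IsModDerivation ∅ (π.map fun ψ => (PropFormMod.ofPropForm ψ).subst σ) := by
  intro k hk
  rw [List.length_map] at hk
  rcases hπ k hk with hm | ⟨r, hr, τ, hconc, hprem⟩
  · refine Or.inr (Or.inl ?_)
    rw [List.getElem_map]
    exact hΓ _ (List.getElem_mem hk) hm
  · refine Or.inr (Or.inr ⟨r, hr, fun v => (PropFormMod.ofPropForm (τ v)).subst σ, ?_, ?_⟩)
    · rw [List.getElem_map, ← hconc, ofPropForm_subst_subst]
    · intro q hq
      rw [← List.map_take, ← ofPropForm_subst_subst]
      exact List.mem_map_of_mem (hprem q hq)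

end Subst

/-! ### Hypothesis elimination in `textbookFrege` -/

section Elim

variable {Γ : Set (PropForm ℕ)}

/-- Appending one admissible line (a hypothesis, or a rule instance whose premises occur earlier)
to a derivation. [Cook–Reckhow 1979, §2] [folklore] -/
theorem isDerivation_append_single {π : List (PropForm ℕ)} {θ : PropForm ℕ}
    (hπ : textbookFrege.IsDerivation Γ π) (hθ : θ ∈ Γ ∨ textbookFrege.IsInferred π θ) :
    textbookFrege.IsDerivation Γ (π ++ [θ]) := by
  intro k hk
  rw [List.length_append, List.length_singleton] at hk
  by_cases hk' : k < π.length
  · rw [List.getElem_append_left hk', List.take_append_of_le_length hk'.le]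
    exact hπ k hk'
  · have hkeq : k = π.length := by omega
    have htake : (π ++ [θ]).take k = π := by
      rw [List.take_append_of_le_length (by omega), hkeq, List.take_length]
    rw [List.getElem_concat_length hkeq, htake]
    exact hθ

/-- A line already derived may be repeated at the end. [folklore] -/
theorem isDerivation_append_of_mem {π : List (PropForm ℕ)} {θ : PropForm ℕ}
    (hπ : textbookFrege.IsDerivation Γ π) (hθ : θ ∈ π) :
    textbookFrege.IsDerivation Γ (π ++ [θ]) := by
  refine isDerivation_append_single hπ ?_
  obtain ⟨j, hj, rfl⟩ := List.getElem_of_mem hθ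
  rcases hπ j hj with hm | ⟨r, hr, τ, hc, hp⟩
  · exact Or.inl hm
  · exact Or.inr ⟨r, hr, τ, hc, fun q hq => List.mem_of_mem_take (hp q hq)⟩

open TextbookFrege (sub3) in
/-- One rule instance of `textbookFrege`, as an `IsInferred` witness. [folklore] -/
theorem isInferred_of_rule {π : List (PropForm ℕ)} {r : FregeRule} (hr : r ∈ textbookFrege.rules)
    (x y z : PropForm ℕ) (hprem : ∀ q ∈ r.premises, q.subst (sub3 x y z) ∈ π) :
    textbookFrege.IsInferred π (r.conclusion.subst (sub3 x y z)) :=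
  ⟨r, hr, sub3 x y z, rfl, hprem⟩

open TextbookFrege (sub3) in
/-- **The six elimination lines.** If `¬H ∨ R` occurs in a derivation from `Γ ∋ H`, appending
`H`, `R ∨ H` (expansion), `¬R ∨ R` (axiom), `H ∨ R` (cut), `R ∨ R` (cut), `R` (contraction) keeps
it a derivation. [Shoenfield 1967, §2.6] [folklore] -/
theorem isDerivation_elim_one {π : List (PropForm ℕ)} {H R : PropForm ℕ}
    (hπ : textbookFrege.IsDerivation Γ π) (hHR : disj (neg H) R ∈ π) (hH : H ∈ Γ) :
    textbookFrege.IsDerivation Γ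
      (π ++ [H] ++ [disj R H] ++ [disj (neg R) R] ++ [disj H R] ++ [disj R R] ++ [R]) := by
  have m0 : ∀ (L : List (PropForm ℕ)) (X : PropForm ℕ), X ∈ L ++ [X] := fun L X => by simp
  have h1 := isDerivation_append_single hπ (θ := H) (Or.inl hH)
  have h2 : textbookFrege.IsDerivation Γ (π ++ [H] ++ [disj R H]) := by
    refine isDerivation_append_single h1 (Or.inr ?_)
    have := isInferred_of_rule (π := π ++ [H]) (r := ⟨[var 0], disj (var 1) (var 0)⟩)
      (by simp [textbookFrege]) H R R (by simp [subst, sub3])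
    simpa [subst, sub3] using this
  have h3 : textbookFrege.IsDerivation Γ (π ++ [H] ++ [disj R H] ++ [disj (neg R) R]) := by
    refine isDerivation_append_single h2 (Or.inr ?_)
    have := isInferred_of_rule (π := π ++ [H] ++ [disj R H]) (r := ⟨[], disj (neg (var 0)) (var 0)⟩)
      (by simp [textbookFrege]) R R R (by simp)
    simpa [subst, sub3] using this
  have h4 : textbookFrege.IsDerivation Γ
      (π ++ [H] ++ [disj R H] ++ [disj (neg R) R] ++ [disj H R]) := by
    refine isDerivation_append_single h3 (Or.inr ?_)
    have := isInferred_of_rule (π := π ++ [H] ++ [disj R H] ++ [disj (neg R) R])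
      (r := ⟨[disj (var 0) (var 1), disj (neg (var 0)) (var 2)], disj (var 1) (var 2)⟩)
      (by simp [textbookFrege]) R H R (by simp [subst, sub3])
    simpa [subst, sub3] using this
  have h5 : textbookFrege.IsDerivation Γ
      (π ++ [H] ++ [disj R H] ++ [disj (neg R) R] ++ [disj H R] ++ [disj R R]) := by
    refine isDerivation_append_single h4 (Or.inr ?_)
    have := isInferred_of_rule (π := π ++ [H] ++ [disj R H] ++ [disj (neg R) R] ++ [disj H R])
      (r := ⟨[disj (var 0) (var 1), disj (neg (var 0)) (var 2)], disj (var 1) (var 2)⟩)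
      (by simp [textbookFrege]) H R R (by simp [subst, sub3, hHR])
    simpa [subst, sub3] using this
  refine isDerivation_append_single h5 (Or.inr ?_)
  have := isInferred_of_rule
    (π := π ++ [H] ++ [disj R H] ++ [disj (neg R) R] ++ [disj H R] ++ [disj R R])
    (r := ⟨[disj (var 0) (var 0)], var 0⟩) (by simp [textbookFrege]) R R R (by simp [subst, sub3])
  simpa [subst, sub3] using this

/-- Depth facts for the elimination lines: relative to `G = ¬H ∨ R`, the lines `H`, `R ∨ H`,
`¬R ∨ R`, `H ∨ R`, `R ∨ R`, `R` have depth `≤ depth G + 2` and size `≤ 2|G| + 1`. [folklore] -/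
theorem elim_lines_bounds (H R : PropForm ℕ) :
    ∀ ψ ∈ [H, disj R H, disj (neg R) R, disj H R, disj R R, R],
      ψ.size ≤ 2 * (disj (neg H) R).size + 1 ∧ ψ.altDepth ≤ (disj (neg H) R).altDepth + 2 := by
  have a1 := altDepthAux_le_succ 0 3 H
  have a2 := altDepthAux_le_succ 3 1 H
  have a3 := altDepthAux_le_succ 0 3 R
  have a4 := altDepthAux_le_succ 1 3 R
  intro ψ hψ
  simp only [List.mem_cons, List.not_mem_nil, or_false] at hψ
  rcases hψ with rfl | rfl | rfl | rfl | rfl | rfl <;>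
    simp only [size, altDepth, altDepthAux, show (0 : ℕ) ≠ 3 from by decide,
      show (3 : ℕ) ≠ 1 from by decide, if_false] <;> omega

/-- **Hypothesis elimination.** From a `textbookFrege`-derivation `π` from `Γ` containing the line
`¬H₁ ∨ (¬H₂ ∨ ⋯ (¬H_N ∨ goal))` with all `Hⱼ ∈ Γ` one reaches `goal` as the LAST line by appending
at most `6N + 1` lines, each of size `≤ 2·|that line| + 1` and depth `≤ its depth + 2`.
[Shoenfield 1967, §2.6] [folklore] -/
theorem exists_elim_hyps (goal : PropForm ℕ) :
    ∀ (Hs : List (PropForm ℕ)) (π : List (PropForm ℕ)), textbookFrege.IsDerivation Γ π →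
      Hs.foldr (fun H R => disj (neg H) R) goal ∈ π → (∀ H ∈ Hs, H ∈ Γ) →
      ∃ π' : List (PropForm ℕ), textbookFrege.IsDerivation Γ (π ++ π') ∧
        (π ++ π').getLast? = some goal ∧ π'.length ≤ 6 * Hs.length + 1 ∧
        ∀ ψ ∈ π', ψ.size ≤ 2 * (Hs.foldr (fun H R => disj (neg H) R) goal).size + 1 ∧
          ψ.altDepth ≤ (Hs.foldr (fun H R => disj (neg H) R) goal).altDepth + 2
  | [], π, hπ, hG, _ => by
    refine ⟨[goal], isDerivation_append_of_mem hπ hG, by simp, by simp, ?_⟩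
    intro ψ hψ
    rw [List.mem_singleton] at hψ
    subst hψ
    simp only [List.foldr_nil]
    omega
  | H :: Hs, π, hπ, hG, hΓ => by
    simp only [List.foldr_cons] at hG ⊢
    set R := Hs.foldr (fun H R => disj (neg H) R) goal with hR
    have hder := isDerivation_elim_one hπ hG (hΓ H (by simp))
    set six : List (PropForm ℕ) := [H] ++ [disj R H] ++ [disj (neg R) R] ++ [disj H R] ++
      [disj R R] ++ [R] with hsix
    have hder' : textbookFrege.IsDerivation Γ (π ++ six) := by
      simpa [hsix, List.append_assoc] using hder
    have hRmem : R ∈ π ++ six := by simp [hsix]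
    obtain ⟨π'', hπ'', hlast, hlen, hbd⟩ :=
      exists_elim_hyps goal Hs (π ++ six) hder' hRmem (fun H' hH' => hΓ H' (by simp [hH']))
    refine ⟨six ++ π'', by simpa [List.append_assoc] using hπ'',
      by simpa [List.append_assoc] using hlast, ?_, ?_⟩
    · simp only [List.length_append, hsix, List.length_cons, List.length_nil]
      omega
    · have hRd : R.altDepth ≤ (disj (neg H) R).altDepth := altDepth_disj_ge_right _ _
      have hRs : R.size ≤ (disj (neg H) R).size := by simp [size]; omega
      rw [← hR] at hbd
      intro ψ hψ
      rcases List.mem_append.1 hψ with hψ | hψ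
      · have hmem : ψ ∈ [H, disj R H, disj (neg R) R, disj H R, disj R R, R] := by
          simpa [hsix] using hψ
        exact elim_lines_bounds H R ψ hmem
      · have := hbd ψ hψ
        omega

end Elim

/-! ### The packaged statement -/

/-- **From an abstract derivation to an `F_d(MOD_a)`-proof with size bound.** Let `π₀` be a
hypothesis-free `textbookFrege`-derivation (lines of depth `≤ dp`, size `≤ sz`) containing
`G = ¬H₁ ∨ (⋯ (¬H_N ∨ goal))` (`|G| ≤ sz`, `depth G + 2 ≤ dp`), and `σ` a substitution of formulas
of size `≤ S` and auxiliary depth `≤ D` turning every `Hⱼ` into a `MOD_a` axiom.  Then the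
`σ`-instance of `goal` has a `textbookFrege(MOD_a)`-proof of depth `≤ dp + D` and size
`≤ (|π₀| + 6N + 1)·(2sz + 1)·S` (eliminate the hypotheses, transfer, bound line by line).
[Buss et al. 1997, Def. 1.1; Shoenfield 1967, §2.6] [folklore] -/
theorem exists_isModDepthProofOf_of_derivation {a : ℕ} {π₀ Hs : List (PropForm ℕ)}
    {goal : PropForm ℕ} (hπ₀ : textbookFrege.IsDerivation ∅ π₀)
    (hG : Hs.foldr (fun H R => disj (neg H) R) goal ∈ π₀) {dp sz : ℕ}
    (hdp : ∀ ψ ∈ π₀, ψ.altDepth ≤ dp) (hsz : ∀ ψ ∈ π₀, ψ.size ≤ sz)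
    (hGdp : (Hs.foldr (fun H R => disj (neg H) R) goal).altDepth + 2 ≤ dp)
    (σ : ℕ → PropFormMod a ℕ) {S D : ℕ} (hS : ∀ v, (σ v).size ≤ S) (hS1 : 1 ≤ S)
    (hD : ∀ v c, PropFormMod.altDepthAux c (σ v) ≤ D)
    (hax : ∀ H ∈ Hs, PropFormMod.IsModAxiom ((PropFormMod.ofPropForm H).subst σ)) :
    ∃ π : List (PropFormMod a ℕ),
      textbookFrege.IsModDepthProofOf (dp + D) π ((PropFormMod.ofPropForm goal).subst σ) ∧
      modProofSize π ≤ (π₀.length + 6 * Hs.length + 1) * ((2 * sz + 1) * S) := by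
  have hGsz : (Hs.foldr (fun H R => disj (neg H) R) goal).size ≤ sz := hsz _ hG
  -- hypotheses `Γ = {H ∈ Hs}`; eliminate them at the abstract level
  let Γ : Set (PropForm ℕ) := {H | H ∈ Hs}
  have hπ₀' : textbookFrege.IsDerivation Γ π₀ := hπ₀.mono (Set.empty_subset _)
  obtain ⟨π', hπ', hlast, hlen, hbd⟩ := exists_elim_hyps goal Hs π₀ hπ₀' hG (fun H hH => hH)
  -- transfer
  let f : PropForm ℕ → PropFormMod a ℕ := fun ψ => (PropFormMod.ofPropForm ψ).subst σ
  have hmod : textbookFrege.IsModDerivation ∅ ((π₀ ++ π').map f) :=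
    isModDerivation_map_subst hπ' σ (fun H _ hH => hax H hH)
  refine ⟨(π₀ ++ π').map f, ⟨⟨hmod, by rw [List.getLast?_map, hlast]; rfl⟩, ?_⟩, ?_⟩
  · -- depth
    intro χ hχ
    obtain ⟨ψ, hψ, rfl⟩ := List.mem_map.1 hχ
    refine (altDepth_ofPropForm_subst_le σ hD ψ).trans (Nat.add_le_add_right ?_ _)
    rcases List.mem_append.1 hψ with hψ | hψ
    · exact hdp ψ hψ
    · have := (hbd ψ hψ).2; omega
  · -- size
    have hline : ∀ ψ ∈ π₀ ++ π', (f ψ).size ≤ (2 * sz + 1) * S := by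
      intro ψ hψ
      refine (size_ofPropForm_subst_le σ hS hS1 ψ).trans (Nat.mul_le_mul_right _ ?_)
      rcases List.mem_append.1 hψ with hψ | hψ
      · have := hsz ψ hψ; omega
      · have := (hbd ψ hψ).1; omega
    have hsum : ∀ (B : ℕ) (L : List (PropForm ℕ)), (∀ ψ ∈ L, (f ψ).size ≤ B) →
        modProofSize (L.map f) ≤ L.length * B := by
      intro B L hL
      induction L with
      | nil => simp [modProofSize]
      | cons ψ L ih =>
        have h1 := hL ψ (by simp)
        have h2 := ih (fun χ hχ => hL χ (by simp [hχ]))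
        have e : modProofSize ((ψ :: L).map f) = (f ψ).size + modProofSize (L.map f) := by
          simp [modProofSize]
        rw [e, List.length_cons, Nat.succ_mul]
        omega
    refine (hsum _ _ hline).trans (Nat.mul_le_mul_right _ ?_)
    simp only [List.length_append]
    omega

end Summit.PneNP.PneNP.Theorems.ModTwo
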